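import Mathlib
import HarnessLib
import Summits.HubbardSuperconductivity.HubbardSuperconductivity.Theorems.KLProgrammeKLRegimeTwoVolumeTowerTruncDefs
import Summits.HubbardSuperconductivity.HubbardSuperconductivity.Theorems.KLProgrammeKLRegimeTwoVolumeTowerTruncSpine
import Summits.HubbardSuperconductivity.HubbardSuperconductivity.Theorems.KLProgrammeKLRegimeTwoVolumeTowerTruncEnd
import Summits.HubbardSuperconductivity.HubbardSuperconductivity.Theorems.KLProgrammeKLRegimeTwoVolumeTowerTruncEndDoor
import Summits.HubbardSuperconductivity.HubbardSuperconductivity.Theorems.KLProgrammeKLRegimeVolumeLimitV9GluedSrcPairDoorAt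

/-!
# Route `KLProgramme` — crux K3, VL child `KLRegimeVolumeLimitV17F2` (stmt-HubbardSuperconductivity-20440), blueprint v5 M5 / W7-T: THE CLOSER MODULO THE
# SOURCE-TRUNCATED DATA — the registered `stub_vl_nestedFramed` from `TowerDataT β U μ` (located «(VL)-SRC-HIGH»; seat hubbard-kl-k3c4-p1 g14; `--supports` 20440)

Twin of `…TwoVolumeTowerCloser` (p602969) on the SOURCE-TRUNCATED tower:

  `TowerDataT β U μ` (`…TowerTruncDefs`, p617446: E1's profiles asked of `srcTrunc 3 (klTowerD …)` only — strings with at most two source legs)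
    —`…TowerTruncSpine.towerTrunc_keyedDefect_eventually_le`→ the truncated keyed defects of all tower states tend to zero
    —`…TowerTruncEnd.towerTrunc_end_keyedDefect_eventually_le`→ so does the keyed defect of the two truncated top read-outs
    —`…TowerTruncEndDoor.towerTrunc_end_glued_inner`→ the inner text of k3c5-p3's door
    —`…VolumeLimitV9GluedSrcPairDoorAt.stub_vl_nestedFramed_of_gluedSrcDefect_keyedAt` (p589727)→ the registered text of `stub_vl_nestedFramed`.

* `gluedInner_of_towerDataT`;
* **`stub_vl_nestedFramed_of_towerDataT`** — the registered statement of `stub_vl_nestedFramed` from `(producer stub) → regime → Nonempty (TowerDataT β U μ)`;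
  since `TowerData.trunc`, this SUPERSEDES p602969 (`stub_vl_nestedFramed_of_towerData` is its special case).

Proofs only; no definition.  Honest framing: a conditional closer; nothing here asserts the data, the stub, K3 or superconductivity.
-/

noncomputable section

namespace Summit.HubbardSuperconductivity.HubbardSuperconductivity.Theorems.TwoVolumeSource

set_option linter.dupNamespace false -- summit = problem name (single-conjunct summit), D-0017

open Finset Filter Topology Literature.MathematicalPhysics.QuantumLattice GrassmannAlgebra Literature.Probability.LatticeModels
  Literature.Probability.LatticeModels.BattleFederbush
open Summit.HubbardSuperconductivity.HubbardSuperconductivity.Theorems.TwoPointAssembly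
open Summit.HubbardSuperconductivity.HubbardSuperconductivity.Theorems.KLRegimeSplit
open Summit.HubbardSuperconductivity.HubbardSuperconductivity.Theorems.KLProgrammeLegKernels
open Summit.HubbardSuperconductivity.HubbardSuperconductivity.Theorems.EngineV8
open Summit.HubbardSuperconductivity.HubbardSuperconductivity.Theorems.TwoVolumeDefect

set_option maxHeartbeats 400000 in -- three large instantiations unified against each other
/-- **The door's inner text from the data package**, fixed `(β, U, μ)` with `0 < β`: spine (W5) → end (W6b) → door shape (W6c).
[folklore: composition; cite: BenfattoGiulianiMastropietro2006, §2.7-§2.9 and §3] -/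
theorem gluedInner_of_towerDataT (β U μ : ℝ) (hβ : 0 < β) (D : TowerDataT β U μ) :
    ∃ L₀ : ℕ, ∃ δ : ℕ → ℝ, Tendsto δ atTop (𝓝 0) ∧ ∃ Rd : ℕ → ℕ, Tendsto Rd atTop atTop ∧
      ∀ (L : ℕ) [NeZero L], L₀ ≤ L → ∀ (L'' : ℕ) [NeZero L''] (b : ℕ), L'' = b * L → ∃ M₀ : ℕ, ∀ (M : ℕ) [NeZero M], M₀ ≤ M →
        ∃ (J : ℕ) (e : (SpaceTimeIdx L'' M × SectorLeg (sectorCount J)) ≃ (Fin 2 → Fin b) × (SpaceTimeIdx L M × SectorLeg (sectorCount J)))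
          (ed : SrcLabel L'' M J ≃ (Fin 2 → Fin b) × SrcLabel L M J),
          (∀ X' i, ((e X').1 i : ℕ) = (X'.1.2 i).val / L) ∧
          (∀ X', (e X').2 = ((X'.1.1, fun i => (((X'.1.2 i).val : ℕ) : ZMod L)), X'.2)) ∧
          (∀ x s, ed (x, s) = ((e x).1, ((e x).2, s))) ∧
        ∃ of : SpaceTimeIdx L'' M, (∀ j, Rd L ≤ (of.2 j).val % L ∧ (of.2 j).val % L + Rd L < L) ∧
          2 * (imagTimeWeight β M)⁻¹ *
            (∑ X ∈ univ.filter (fun X : Fin 2 → SrcLabel L'' M J => X 0 = ((of, ((⟨0, sectorCount_pos _⟩, 0), 0)), 1) ∧ (X 1).2 = 1),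
              ‖kernel ℂ (srcTrunc ℂ (fun Y : SrcLabel L'' M J => Y.2 = 1) 3
                    (ExteriorAlgebra.map (Matrix.toLin' (((imagTimeWeight β M : ℝ) : ℂ) •
                        klSrcAnalysisAt L'' M β μ (klFlowFrameU L'' M β U μ (nScales β + 1)) J))
                      (klEffectiveAction L'' M β U μ (klFlowFrameU L'' M β U μ (nScales β + 1)) klE0 (nScales β + 1)))) 2 X -
                  (if ∀ i, (ed (X i)).1 = (ed (X 0)).1 then
                    kernel ℂ (srcTrunc ℂ (fun Y : SrcLabel L M J => Y.2 = 1) 3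
                      (ExteriorAlgebra.map (Matrix.toLin' (((imagTimeWeight β M : ℝ) : ℂ) •
                          klSrcAnalysisAt L M β μ (klFlowFrameU L M β U μ (nScales β + 1)) J))
                        (klEffectiveAction L M β U μ (klFlowFrameU L M β U μ (nScales β + 1)) klE0 (nScales β + 1)))) 2
                      (fun i => (ed (X i)).2)
                  else 0)‖) ≤ δ L := by
  -- the frames as a total function of the volume (the flow frame needs `NeZero V`)
  obtain ⟨Kfr, hK⟩ : ∃ Kfr : ℕ → ℕ → TrigPolyC4v, ∀ (V M : ℕ) [NeZero V] [NeZero M], Kfr V M = klFlowFrameU V M β U μ (nScales β + 1) :=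
    ⟨fun V M => if hV : V = 0 then 0 else if hM : M = 0 then 0 else
        (haveI : NeZero V := ⟨hV⟩; haveI : NeZero M := ⟨hM⟩; klFlowFrameU V M β U μ (nScales β + 1)),
      fun V M _ _ => by simp only [dif_neg (NeZero.ne V), dif_neg (NeZero.ne M)]⟩
  -- admissibility with a positive cutoff (the normalisation `ε_M = β/(2M)` is then positive)
  have hε : ∀ L b M, (D.Mth L b ≤ M ∧ 0 < M) → 0 < imagTimeWeight β M := fun L b M h => by
    have hM : (0 : ℝ) < M := Nat.cast_pos.2 h.2
    unfold imagTimeWeight; positivity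
  have hdata' : ∀ᶠ L in atTop, ∀ (b M : ℕ) [NeZero L] [NeZero (b * L)] [NeZero M], (D.Mth L b ≤ M ∧ 0 < M) →
      TowerVolumeDataT L M β U μ (Kfr L M) (nScales β) (imagTimeWeight β M) D.Λ D.κ D.aW D.sW D.NV ∧
        TowerVolumeDataT (b * L) M β U μ (Kfr (b * L) M) (nScales β) (imagTimeWeight β M) D.Λ D.κ D.aW D.sW D.NV ∧
          TowerCrossData L b M β μ (Kfr L M) (Kfr (b * L) M) (nScales β) (imagTimeWeight β M)
            D.Λ D.κ' D.aW' D.sW' D.eW' D.ΛT D.cW D.κf (fun j => D.sE j L) (fun j => D.cR j L) (fun j => D.cC j L) (fun j => D.δ j L) := by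
    filter_upwards [D.hdata] with L hL
    intro b M iL ibL iM h
    rw [hK L M, hK (b * L) M]
    exact hL b M h.1
  have h0' : ∀ (k : ℕ) (η : ℝ), 0 < η → ∀ᶠ L in atTop, ∀ (b M : ℕ) [NeZero L] [NeZero (b * L)] [NeZero M], (D.Mth L b ≤ M ∧ 0 < M) →
      ∀ (p : Fin k) (w : SrcLabel (b * L) M 0), (∀ i, 2 * D.r L ≤ (w.1.1.2 i).val % L ∧ (w.1.1.2 i).val % L + 2 * D.r L < L) →
        klKeyedDefectT L b M β U μ (Kfr L M) (Kfr (b * L) M) 0 k p w ≤ imagTimeWeight β M * η := by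
    intro k η hη
    filter_upwards [D.h0 k η hη] with L hL
    intro b M iL ibL iM h
    rw [hK L M, hK (b * L) M]
    exact hL b M h.1
  -- W5: the spine
  have hspine := towerTrunc_keyedDefect_eventually_le β U μ hβ.ne' Kfr (nScales β)
    (fun L b M => D.Mth L b ≤ M ∧ 0 < M) (fun M => imagTimeWeight β M) hε D.r D.hr
    D.Λ D.κ D.aW D.sW D.κ' D.aW' D.sW' D.eW' D.ΛT D.cW D.κf D.cRb D.cCb D.δb D.ρ₀ D.ρf D.ρ₂ D.ρ' D.ρ₃ D.ν₀ D.ν₁ D.ν₂ D.ν₃ D.ν₄ D.ν₅ D.νE D.ν₆ D.ν₇ D.ν₈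
    D.NV D.NS D.hΛ D.hΛmono D.hΛT D.hκ D.haW D.hρ D.hNV0 D.hNSnn D.hNS0 D.hNSsucc D.hsm D.sE D.cR D.cC D.δ D.hmis D.hmis0 hdata' h0'
    (nScales β) le_rfl
  -- W6b: the end
  have hend := towerTrunc_end_keyedDefect_eventually_le β U μ hβ.ne' Kfr (nScales β)
    (fun L b M => D.Mth L b ≤ M ∧ 0 < M) (fun M => imagTimeWeight β M) hε D.r D.hr
    D.Λ D.κ D.aW D.sW D.κ' D.aW' D.sW' D.eW' D.ΛT D.cW D.κf D.ρ₀ D.ν₀ (D.δb (nScales β)) D.NV D.NS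
    D.hΛ (D.hΛT _) (D.haW _).2.2.2.2.2.1 (fun j => (D.hρ j).1) D.hNV0 D.hNSnn (fun j hj => (D.hsm j hj).hν₀) (fun j hj => (D.hsm j hj).hθ₀) D.hNS0 D.hNSsucc
    D.sE D.cR D.cC D.δ (fun L => ⟨(D.hmis _ L).2.2.2.1, (D.hmis _ L).2.2.2.2.2.2⟩) (D.hmis0 _).2.2.2 hdata' hspine
  -- W6c: the door's shape (instances with a positive cutoff are the admissible ones; frames by name)
  refine towerTrunc_end_glued_inner β U μ hβ D.Mth D.r D.hr D.hRd fun k η hη => ?_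
  filter_upwards [hend k η hη] with L hL
  intro b M iL ibL iM hM
  rw [← hK L M, ← hK (b * L) M]
  exact hL b M ⟨hM, Nat.pos_of_ne_zero (NeZero.ne M)⟩

/-- **THE CLOSER MODULO THE SOURCE-TRUNCATED DATA**: the registered statement of `stub_vl_nestedFramed` («cauchy» v9/v9b) from an inhabitant of
`TowerDataT β U μ` under the regime hypotheses (and the producer stub's statement). [folklore: composition; cite: BenfattoGiulianiMastropietro2006, §2.7-§2.9 and §3] -/
theorem stub_vl_nestedFramed_of_towerDataT
    (hT : (∀ (P : SplitConsts) (R : RenConsts), P.WF → R.WF2 →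
      ∃ Q' : EngConsts, 0 ≤ Q'.CE ∧ ∃ c₀ : ℝ, 0 < c₀ ∧ ∀ c : ℝ, 0 < c → c ≤ c₀ → ∃ U₀ : ℝ, 0 < U₀ ∧
        ∀ μ ∈ klWindowC, ∀ U : ℝ, 0 < U → U ≤ U₀ → ∀ β : ℝ, klBetaMin ≤ β → β ≤ Real.exp (c / U ^ 2) →
          ∃ A : ℕ → ℕ → ℝ, ∃ L₁ : ℕ, ∃ M₁ : ℕ → ℕ, ∀ (L M : ℕ) [NeZero L] [NeZero M], L₁ ≤ L → M₁ L ≤ M →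
            ∀ j : ℕ, j ≤ nScales β + 1 →
              SourceProfilesAt L M (klSrcBudget P Q' U A j) β U μ (klFlowFrameU L M β U μ (nScales β + 1)) j) →
    ∀ (G : GeoConsts) (P : SplitConsts) (Q : EngConsts) (R : RenConsts), G.WF → P.WF → Q.WF → R.WF →
      ∃ c₅ : ℝ, 0 < c₅ ∧ ∀ c : ℝ, 0 < c → c ≤ c₅ → ∃ U₀ : ℝ, 0 < U₀ ∧
        ∀ μ ∈ klWindowC, ∀ U : ℝ, 0 < U → U ≤ U₀ → ∀ β : ℝ, klBetaMin ≤ β → β ≤ Real.exp (c / U ^ 2) →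
          ∀ K : TrigPolyC4v, klPredsV17F2.frameOK R U (nScales β) μ K →
            ∀ (Lstar : ℕ) (Mstar : ℕ → ℕ), TowerP klPredsV17F2 G P Q R β U μ K Lstar Mstar →
              Nonempty (TowerDataT β U μ)) :
    (∀ (P : SplitConsts) (R : RenConsts), P.WF → R.WF2 →
      ∃ Q' : EngConsts, 0 ≤ Q'.CE ∧ ∃ c₀ : ℝ, 0 < c₀ ∧ ∀ c : ℝ, 0 < c → c ≤ c₀ → ∃ U₀ : ℝ, 0 < U₀ ∧
        ∀ μ ∈ klWindowC, ∀ U : ℝ, 0 < U → U ≤ U₀ → ∀ β : ℝ, klBetaMin ≤ β → β ≤ Real.exp (c / U ^ 2) →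
          ∃ A : ℕ → ℕ → ℝ, ∃ L₁ : ℕ, ∃ M₁ : ℕ → ℕ, ∀ (L M : ℕ) [NeZero L] [NeZero M], L₁ ≤ L → M₁ L ≤ M →
            ∀ j : ℕ, j ≤ nScales β + 1 →
              SourceProfilesAt L M (klSrcBudget P Q' U A j) β U μ (klFlowFrameU L M β U μ (nScales β + 1)) j) →
    ∀ (G : GeoConsts) (P : SplitConsts) (Q : EngConsts) (R : RenConsts), G.WF → P.WF → Q.WF → R.WF →
      ∃ c₅ : ℝ, 0 < c₅ ∧ ∀ c : ℝ, 0 < c → c ≤ c₅ → ∃ U₀ : ℝ, 0 < U₀ ∧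
        ∀ μ ∈ klWindowC, ∀ U : ℝ, 0 < U → U ≤ U₀ → ∀ β : ℝ, klBetaMin ≤ β → β ≤ Real.exp (c / U ^ 2) →
          ∀ K : TrigPolyC4v, klPredsV17F2.frameOK R U (nScales β) μ K →
            ∀ (Lstar : ℕ) (Mstar : ℕ → ℕ), TowerP klPredsV17F2 G P Q R β U μ K Lstar Mstar →
              ∀ n : ℤ, ∃ L₀ : ℕ, ∃ ρ : ℕ → ℝ, Tendsto ρ atTop (𝓝 0) ∧
                ∀ (L : ℕ) [NeZero L], L₀ ≤ L → ∀ (L'' : ℕ) [NeZero L''], L ∣ L'' → ∃ M₀ : ℕ, ∀ (M : ℕ) [NeZero M], M₀ ≤ M →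
                  ∀ (ω : MatsubaraIdx M), matsubaraInt M ω = n → ∀ (k : TorusSite 2 L) (k'' : TorusSite 2 L''),
                    latticeMomentum L'' k'' = latticeMomentum L k →
                      ‖klSelfEnergy L M β U μ (klFlowFrameU L M β U μ (nScales β + 1)) klE0 (nScales β + 1) (ω, k) 0 -
                          klSelfEnergy L'' M β U μ (klFlowFrameU L'' M β U μ (nScales β + 1)) klE0 (nScales β + 1) (ω, k'') 0‖ ≤ ρ L := by
  intro hSrc
  refine stub_vl_nestedFramed_of_gluedSrcDefect_keyedAt (fun G P Q R hG hP hQ hR => ?_) hSrc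
  obtain ⟨c₅, hc₅, hc⟩ := hT hSrc G P Q R hG hP hQ hR
  refine ⟨c₅, hc₅, fun c hc0 hcc => ?_⟩
  obtain ⟨U₀, hU₀, hU⟩ := hc c hc0 hcc
  refine ⟨U₀, hU₀, fun μ hμ U hU0 hUU β hβmin hβmax K hK Lstar Mstar hTP => ?_⟩
  obtain ⟨D⟩ := hU μ hμ U hU0 hUU β hβmin hβmax K hK Lstar Mstar hTP
  exact gluedInner_of_towerDataT β U μ (KLRegimeSplit.pos_of_klBetaMin_le hβmin) D

end Summit.HubbardSuperconductivity.HubbardSuperconductivity.Theorems.TwoVolumeSource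

end
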